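import Literature.AnabelianGeometry.EtaleTheta.Discharge.Sec3Cor38Rows
import Literature.AnabelianGeometry.EtaleTheta.Discharge.Sec3Cor38Hull
import Literature.AnabelianGeometry.EtaleTheta.Discharge.Sec3Cor38HullObjects
import Literature.AnabelianGeometry.EtaleTheta.Discharge.Sec3Cor38Criterion
import Literature.AnabelianGeometry.EtaleTheta.Discharge.Sec3Cor38PerfectionR
import Literature.AnabelianGeometry.EtaleTheta.Discharge.Sec3Cor38PerfectionMapTransport
import Literature.AnabelianGeometry.EtaleTheta.Discharge.Sec3Remark363
import Literature.AlgebraicGeometry.Frobenioids.EquivalenceThm34OfThm34ii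
import Literature.AlgebraicGeometry.Frobenioids.IsoSubanchorNotIsotropic
import Literature.AlgebraicGeometry.Frobenioids.DivisorMonoidCategoryTheoreticityFacts

/-!
# [EtTh] Corollary 3.8 (ii) — the node's closing theorem KNIT END TO END from the landed rows:
# `Cor38_ii` from the printed inputs of its proof, BY NAME

Mochizuki, *The étale theta function …*, Publ. RIMS **45** (2009), Cor. 3.8 (ii), PDF pp. 80–82 (printed
306–308), proof p.81 l.13 – p.82 l.5 [cite: MochizukiEtTh2009, Cor 3.8 p.81]; the [FrdI] inputs it quotes:
Mochizuki, *The geometry of Frobenioids I*, Kyushu J. Math. **62** (2008), Thm. 3.4 (ii)(iii) p.62, Cor. 4.11 (ii)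
p.91, Def. 4.5 (iv) p.86 [cite: MochizukiFrdI2008, Cor. 4.11 (ii) p.91]. abc-iut cell, layer L2, cone node
`EtTh:Cor3.8(ii)` (kernel id `N_EtTh_Cor3_8_ii`), seat abc-iut-w6-d040 (block C / W6; the node-level assembly was
yielded to this seat by the sub-DAG's one-writer abc-iut-w5-d124, whose staged draft `Sec3Cor38iiHolds` this file
mines — rows L04 (ii), the Def. 4.5 (iv) instantiation). PROOF-ONLY (0 definitions) companion of abc-iut-L2-t3's
`TemperedFrobenioidProps.lean` (`Cor38Hyp`, `Cor38_ii`, p407532) over the frozen statements-first sub-DAG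
`TemperedFrobenioidCor38Sub.lean` (abc-iut-w5-d124, p414329; rows C38-L01 … L10, plan/L2/SUBDAG-EtTh-Cor38.md) and
its landed companions: `Sec3Cor38Rows` p414844 (L07b, L09), `Sec3Cor38Hull` p415309 (L10), `Sec3Cor38HullObjects`
p417120 (Rmk. 3.6.3 object clause), `Sec3Cor38Transport` p416298 + `Sec3Cor38PerfectionMapTransport` p429605 (L06
with all `Ψ^pf`-level transports discharged), `Sec3Cor38PerfectionR` p429204 (L03′), `Sec3Cor38Criterion*`
p419648–p422576 (L05), `Sec3Remark363` p427171 (abc-iut-w5-d135: `hull` faithful, Rmk. 3.6.3).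

WHAT THIS FILE ADDS (composition only — no row is re-proved, nothing re-typed): the sub-DAG's `cor38_ii_of_rows`
takes the ROWS as hypotheses; here every row-level hypothesis is replaced by its landed derivation, so that

  `Cor38Hyp.cor38_ii_of_criterion : … → Literature.AnabelianGeometry.EtaleTheta.Cor38_ii IsDivSlim h`

has as explicit binders ONLY printed inputs of the proof, by name:
* `h34 : FrdI.Thm34ii` — [FrdI] Thm. 3.4 (ii) as the cell's 0-ary named fact F-0711, status PROVED
  (`FrdI.Thm34ii_holds`, abc-iut-L1-t11 `EquivalencePreStepsFSMFF2008Assembly`, p427329 — a binder only because that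
  module had no olean on the farm when this file was checked; the consumer discharges it by name). From it the file
  derives Thm. 3.4 (ii) AND (iii) (abc-iut-L1-t13 `FrdI.thm34iii_iv_v_of_thm34ii`) for `Ψ` and `Ψ⁻¹`, hence rows
  C38-L02a (pre-steps), L07 (factorisation), the Frobenius-compatibility of `Ψ^{±1}` (C38-L03′ input), the linear
  half of L04; hypothesis (b) `HypB` is vacuous (C38-L01), quasi-isotropy is [FrdI] Rmk. 3.1.1;
* `hF_i` — [FrdI] Thm. 5.2 (ii), "the tempered Frobenioid is a Frobenioid" (the sub-DAG's standing binder);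
* `H` — C38-L01 = `StandardIsotropicNotGroupLike` ([EtTh] Thm. 3.7 (i)(ii); [FrdI] Thm. 4.2 setting);
* `h411`, `h411'` — [FrdI] Cor. 4.11 (ii) for `Ψ`, `Ψ⁻¹` (typed per instance; F-1026 conditional in L1), feeding
  L04 case (ii) (`O^▷(−)` via the base squares) and L09 (Frobenius-trivial objects);
* `h5_i` — row C38-L05, the intrinsic criterion, AT THE PERFECTIONS `PreFrobenioidData.perfection hF_i` (any
  producer plugs in; `cor38_ii_of_inputs` plugs abc-iut-w5-d124's `bsFldPreStepLimitCriterion_of`, i.e. the cell's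
  GAP-LEDGER binders G-w5d124-1 `hP34Λ`, -2 `hNZ`, -3 `hSup`, per side);
* `hR_i` — [EtTh] Rmk. 3.6.3 (`Remark363`, F-0581) and `hO_i` its object clause (`HullEssImageObjClause`) —
  the latter a theorem at the tree vocabulary (`cor38_ii_of_criterion_tree` drops it);
* `hvoc_i` — the bridge from abc-iut-L2-t3's vocabulary PARAMETER `IsDivSlim (E) (Φ)` to L1's
  `PreFrobenioidData.IsDivSlim` of the operations; `cor38_ii_of_criterion_tree` instead INSTANTIATES the parameter
  with [FrdI] Def. 4.5 (iv) read on `(D, Φ)` (the literal body of L1's definition; bridge `⟨·⟩`), as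
  `cor38_i_of_rows` did with `IsFrobeniusSlim`.
DISCHARGED inside, by name: hull faithfulness (`hullFaithful_holds`), C38-L06 with all four `Ψ^pf`-transports
(`preservesBsFldPreSteps_of_C_rows`), L07b/L07c (`bsFldOfFactorisation_/hasFactorisations_of_isFrobenioid`), L08,
L09, L10.  HONEST FRAMING: refereed pre-IUT material ([EtTh] §3 over [FrdI] §§3–4); nothing here bears on
[IUTchIII] Cor. 3.12; no side taken; typed ≠ proved — here proved modulo the displayed named binders.
-/

namespace Literature.AnabelianGeometry.EtaleTheta

open CategoryTheory Opposite Literature.AlgebraicGeometry.Frobenioids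

universe u₀ v₀ u v w

section General

variable {D₀ : Type u₀} [Category.{v₀} D₀] {V : FrdIMonoidStub.{w}}
  {T : RealifiedDivisorMonoids (D₀ := D₀) V} {D : Type u} [Category.{v} D] {VD : FrdICatStub.{u, v, w} D}
  {D₀' : Type u₀} [Category.{v₀} D₀'] {T' : RealifiedDivisorMonoids (D₀ := D₀') V}
  {D' : Type u} [Category.{v} D'] {VD' : FrdICatStub.{u, v, w} D'}
  {C₁ : TemperedFrobenioid T D VD} {C₂ : TemperedFrobenioid T' D' VD'}

namespace Cor38Hyp

variable (h : Cor38Hyp C₁ C₂)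

/-! ### §1 The [FrdI] Thm. 3.4 inputs, from the 0-ary named fact `FrdI.Thm34ii` (F-0711) -/

/-- [FrdI] Thm. 3.4 (ii) for `Ψ`, BY NAME from the 0-ary fact `FrdI.Thm34ii` (F-0711; in the tree:
`FrdI.Thm34ii_holds`), the tempered Frobenioids being Frobenioids ([FrdI] Thm. 5.2 (ii)).
[cite: MochizukiFrdI2008, Thm. 3.4 (ii) p.62] -/
theorem thm34ii_of_fact (h34 : FrdI.Thm34ii.{w, v, max v w, u, max u w})
    (hF₁ : PreFrobenioid.IsFrobenioid C₁.toElem) (hF₂ : PreFrobenioid.IsFrobenioid C₂.toElem) :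
    C₁.opsData.Thm34ii C₂.opsData h.Ψ :=
  h34 C₁.toElem C₂.toElem hF₁ hF₂ h.Ψ

/-- [FrdI] Thm. 3.4 (ii) for `Ψ⁻¹`, by name. [cite: MochizukiFrdI2008, Thm. 3.4 (ii) p.62] -/
theorem thm34ii_symm_of_fact (h34 : FrdI.Thm34ii.{w, v, max v w, u, max u w})
    (hF₁ : PreFrobenioid.IsFrobenioid C₁.toElem) (hF₂ : PreFrobenioid.IsFrobenioid C₂.toElem) :
    C₂.opsData.Thm34ii C₁.opsData h.Ψ.symm :=
  h34 C₂.toElem C₁.toElem hF₂ hF₁ h.Ψ.symm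

/-- [FrdI] Thm. 3.4 (iii) (morphisms and Frobenius degrees) for `Ψ`, BY NAME — from (ii) through abc-iut-L1-t13's
`FrdI.thm34iii_iv_v_of_thm34ii`. [cite: MochizukiFrdI2008, Thm. 3.4 (iii) p.62] -/
theorem thm34iii_of_fact (h34 : FrdI.Thm34ii.{w, v, max v w, u, max u w})
    (hF₁ : PreFrobenioid.IsFrobenioid C₁.toElem) (hF₂ : PreFrobenioid.IsFrobenioid C₂.toElem) :
    C₁.opsData.Thm34iii C₂.opsData h.Ψ :=
  (FrdI.thm34iii_iv_v_of_thm34ii h34).1 C₁.toElem C₂.toElem hF₁ hF₂ h.Ψ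

/-- [FrdI] Thm. 3.4 (iii) for `Ψ⁻¹`, by name. [cite: MochizukiFrdI2008, Thm. 3.4 (iii) p.62] -/
theorem thm34iii_symm_of_fact (h34 : FrdI.Thm34ii.{w, v, max v w, u, max u w})
    (hF₁ : PreFrobenioid.IsFrobenioid C₁.toElem) (hF₂ : PreFrobenioid.IsFrobenioid C₂.toElem) :
    C₂.opsData.Thm34iii C₁.opsData h.Ψ.symm :=
  (FrdI.thm34iii_iv_v_of_thm34ii h34).1 C₂.toElem C₁.toElem hF₂ hF₁ h.Ψ.symm

/-- `C₁`, `C₂` are of quasi-isotropic type (isotropic type, C38-L01; [FrdI] Rmk. 3.1.1,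
`isOfQuasiIsotropicType_of_isOfIsotropicType`). [cite: MochizukiEtTh2009, Cor 3.8 p.81] -/
theorem isOfQuasiIsotropicType_of (hF₁ : PreFrobenioid.IsFrobenioid C₁.toElem)
    (hF₂ : PreFrobenioid.IsFrobenioid C₂.toElem) (H : h.StandardIsotropicNotGroupLike) :
    C₁.opsData.IsOfQuasiIsotropicType ∧ C₂.opsData.IsOfQuasiIsotropicType :=
  ⟨isOfQuasiIsotropicType_of_isOfIsotropicType C₁.divisorMonoid C₁.toElem hF₁ H.isotropic.1,
    isOfQuasiIsotropicType_of_isOfIsotropicType C₂.divisorMonoid C₂.toElem hF₂ H.isotropic.2⟩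

/-- **C38-L02a by name** (p.81: "`Ψ` preserves pre-steps"): from [FrdI] Thm. 3.4 (ii) for `Ψ`, `Ψ⁻¹`, quasi-isotropy
and `D_i` of FSMFF-type (`h.fsmff`). [cite: MochizukiEtTh2009, Cor 3.8 p.81] -/
theorem preservesPreSteps_of_fact (h34 : FrdI.Thm34ii.{w, v, max v w, u, max u w})
    (hF₁ : PreFrobenioid.IsFrobenioid C₁.toElem) (hF₂ : PreFrobenioid.IsFrobenioid C₂.toElem)
    (H : h.StandardIsotropicNotGroupLike) : h.PreservesPreSteps :=
  h.preservesPreSteps_of_thm34ii (h.thm34ii_of_fact h34 hF₁ hF₂) (h.thm34ii_symm_of_fact h34 hF₁ hF₂)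
    (h.isOfQuasiIsotropicType_of hF₁ hF₂ H).1 (h.isOfQuasiIsotropicType_of hF₁ hF₂ H).2

/-- **C38-L07 by name** (p.81: "`Ψ` preserves the factorization …"): from C38-L02a and [FrdI] Thm. 3.4 (iii) for
`Ψ`, `Ψ⁻¹`; hypothesis (b) vacuous (C38-L01). [cite: MochizukiEtTh2009, Cor 3.8 p.81] -/
theorem preservesFactorisation_of_fact (h34 : FrdI.Thm34ii.{w, v, max v w, u, max u w})
    (hF₁ : PreFrobenioid.IsFrobenioid C₁.toElem) (hF₂ : PreFrobenioid.IsFrobenioid C₂.toElem)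
    (H : h.StandardIsotropicNotGroupLike) : h.PreservesFactorisation :=
  h.preservesFactorisation_of_thm34 (h.preservesPreSteps_of_fact h34 hF₁ hF₂ H)
    (h.thm34iii_of_fact h34 hF₁ hF₂) (h.thm34iii_symm_of_fact h34 hF₁ hF₂) H
    (h.hypB_of_standardIsotropicNotGroupLike H) (h.hypB_symm_of_standardIsotropicNotGroupLike H)

/-- `Ψ` carries arrows of Frobenius type to such, of the same degree (the input of C38-L03′ `Ψ^pf`; [FrdI] Thm.
3.4 (iii) by name, abc-iut-w5-d124's `isFrobeniusCompatible_of_thm34iii`). [cite: MochizukiEtTh2009, Cor 3.8 p.81] -/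
theorem isFrobeniusCompatible_of_fact (h34 : FrdI.Thm34ii.{w, v, max v w, u, max u w})
    (hF₁ : PreFrobenioid.IsFrobenioid C₁.toElem) (hF₂ : PreFrobenioid.IsFrobenioid C₂.toElem)
    (H : h.StandardIsotropicNotGroupLike) :
    PreFrobenioid.IsFrobeniusCompatible C₁.toElem C₂.toElem h.Ψ.functor :=
  h.isFrobeniusCompatible_of_thm34iii (h.thm34iii_of_fact h34 hF₁ hF₂) H

/-- … and so does `Ψ⁻¹` (Thm. 3.4 (iii) for the equivalence `Ψ⁻¹`, with the Cor. 3.8 data reversed).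
[cite: MochizukiEtTh2009, Cor 3.8 p.81] -/
theorem isFrobeniusCompatible_inverse_of_fact (h34 : FrdI.Thm34ii.{w, v, max v w, u, max u w})
    (hF₁ : PreFrobenioid.IsFrobenioid C₁.toElem) (hF₂ : PreFrobenioid.IsFrobenioid C₂.toElem)
    (H : h.StandardIsotropicNotGroupLike) :
    PreFrobenioid.IsFrobeniusCompatible C₂.toElem C₁.toElem h.Ψ.inverse :=
  Cor38Hyp.isFrobeniusCompatible_of_thm34iii
    (⟨h.Ψ.symm, ⟨h.fsmff.2, h.fsmff.1⟩, ⟨h.nonDilating.2, h.nonDilating.1⟩⟩ : Cor38Hyp C₂ C₁)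
    (h.thm34iii_symm_of_fact h34 hF₁ hF₂) (h.standardIsotropicNotGroupLike_symm H)

/-- **C38-L04, case (ii), by name** (p.81: "by … [Mzk17], Corollary 4.11, (ii) … `Ψ` preserves the submonoids
'`O^▷(−)`'"): from the base squares of [FrdI] Cor. 4.11 (ii) for `Ψ`, `Ψ⁻¹` (`D_i` Div-slim) and the linear half
of Thm. 3.4 (iii) (frozen rows `baseSquare(Inv)_of_cor411ii`, `preservesLinear_of_thm34iii`,
`preservesOTri_of_baseSquare`; this composition is abc-iut-w5-d124's). [cite: MochizukiEtTh2009, Cor 3.8 p.81] -/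
theorem preservesOTri_of_fact (h34 : FrdI.Thm34ii.{w, v, max v w, u, max u w})
    (hF₁ : PreFrobenioid.IsFrobenioid C₁.toElem) (hF₂ : PreFrobenioid.IsFrobenioid C₂.toElem)
    (H : h.StandardIsotropicNotGroupLike)
    (h411 : C₁.opsData.Cor411ii C₂.opsData h.Ψ) (h411' : C₂.opsData.Cor411ii C₁.opsData h.Ψ.symm)
    (hds : C₁.opsData.IsDivSlim ∧ C₂.opsData.IsDivSlim) : h.PreservesOTri :=
  h.preservesOTri_of_baseSquare
    (h.baseSquare_of_cor411ii h411 hds H (h.hypB_of_standardIsotropicNotGroupLike H))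
    (h.baseSquareInv_of_cor411ii h411' hds H (h.hypB_symm_of_standardIsotropicNotGroupLike H))
    (h.preservesLinear_of_thm34iii (h.thm34iii_of_fact h34 hF₁ hF₂) (h.thm34iii_symm_of_fact h34 hF₁ hF₂) H
      (h.hypB_of_standardIsotropicNotGroupLike H) (h.hypB_symm_of_standardIsotropicNotGroupLike H))

/-- **C38-L09 by name** (p.82 l.1: "`Ψ` preserves … the Frobenius-trivial objects"): base squares of Cor. 4.11 (ii)
+ Thm. 3.4 (iii), via the frozen derivation `preservesFrobeniusTrivial_of_inputs`. [cite: MochizukiEtTh2009, Cor 3.8 p.82] -/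
theorem preservesFrobeniusTrivial_of_fact (h34 : FrdI.Thm34ii.{w, v, max v w, u, max u w})
    (hF₁ : PreFrobenioid.IsFrobenioid C₁.toElem) (hF₂ : PreFrobenioid.IsFrobenioid C₂.toElem)
    (H : h.StandardIsotropicNotGroupLike)
    (h411 : C₁.opsData.Cor411ii C₂.opsData h.Ψ) (h411' : C₂.opsData.Cor411ii C₁.opsData h.Ψ.symm)
    (hds : C₁.opsData.IsDivSlim ∧ C₂.opsData.IsDivSlim) : h.PreservesFrobeniusTrivial :=
  h.preservesFrobeniusTrivial_of_inputs
    (h.baseSquare_of_cor411ii h411 hds H (h.hypB_of_standardIsotropicNotGroupLike H))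
    (h.baseSquareInv_of_cor411ii h411' hds H (h.hypB_symm_of_standardIsotropicNotGroupLike H))
    (h.thm34iii_of_fact h34 hF₁ hF₂) (h.thm34iii_symm_of_fact h34 hF₁ hF₂) H
    (h.hypB_of_standardIsotropicNotGroupLike H) (h.hypB_symm_of_standardIsotropicNotGroupLike H)

/-- **C38-L06 by name** (p.81: "Thus, `Ψ` preserves the base-field-theoretic pre-steps"), given the criterion
C38-L05 on both sides at THE perfections and Div-slimness: abc-iut-w5-d124's `preservesBsFldPreSteps_of_C_rows`
(all four `Ψ^pf`-transports discharged) fed with C38-L02a, C38-L04 (ii) and the Frobenius-compatibility of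
`Ψ^{±1}` derived above. [cite: MochizukiEtTh2009, Cor 3.8 p.81] -/
theorem preservesBsFldPreSteps_of_fact (h34 : FrdI.Thm34ii.{w, v, max v w, u, max u w})
    (hF₁ : PreFrobenioid.IsFrobenioid C₁.toElem) (hF₂ : PreFrobenioid.IsFrobenioid C₂.toElem)
    (H : h.StandardIsotropicNotGroupLike)
    (h411 : C₁.opsData.Cor411ii C₂.opsData h.Ψ) (h411' : C₂.opsData.Cor411ii C₁.opsData h.Ψ.symm)
    (hds : C₁.opsData.IsDivSlim ∧ C₂.opsData.IsDivSlim)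
    (h5₁ : C₁.BsFldPreStepLimitCriterion (PreFrobenioidData.perfection hF₁))
    (h5₂ : C₂.BsFldPreStepLimitCriterion (PreFrobenioidData.perfection hF₂)) : h.PreservesBsFldPreSteps :=
  h.preservesBsFldPreSteps_of_C_rows hF₁ hF₂ (h.isFrobeniusCompatible_of_fact h34 hF₁ hF₂ H)
    (h.isFrobeniusCompatible_inverse_of_fact h34 hF₁ hF₂ H) (h.preservesPreSteps_of_fact h34 hF₁ hF₂ H)
    (h.preservesOTri_of_fact h34 hF₁ hF₂ H h411 h411' hds) h5₁ h5₂

/-! ### §2 The knit over any vocabulary -/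

/-- **[EtTh] Cor. 3.8 (ii) AS TYPED (`Cor38_ii IsDivSlim h`) from the printed inputs of its proof BY NAME** —
binders: `hvoc_i` (vocabulary bridge, as in `cor38_ii_of_rows`) · `h34` = [FrdI] Thm. 3.4 (ii) (0-ary fact F-0711,
proved in the tree) · `hF_i` ([FrdI] Thm. 5.2 (ii)) · `H` = C38-L01 ([EtTh] Thm. 3.7 (i)(ii)) · [FrdI] Cor. 4.11 (ii)
for `Ψ`, `Ψ⁻¹` · the criterion C38-L05 at THE perfections, both sides · [EtTh] Rmk. 3.6.3 and its object clause,
both sides.  Everything else on the printed route (Thm. 3.4 (iii), `HypB`, quasi-isotropy, `Ψ^pf` and its four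
transports, hull faithfulness, rows L02a, L04, L06, L07, L07b, L07c, L08, L09, L10) is consumed from the tree.
[cite: MochizukiEtTh2009, Cor 3.8 p.81] -/
theorem cor38_ii_of_criterion
    (IsDivSlim : ∀ (E : Type u) [Category.{v} E], (Eᵒᵖ ⥤ CommMonCat.{w}) → Prop)
    (hvoc₁ : IsDivSlim D C₁.divisorMonoid → C₁.opsData.IsDivSlim)
    (hvoc₂ : IsDivSlim D' C₂.divisorMonoid → C₂.opsData.IsDivSlim)
    (h34 : FrdI.Thm34ii.{w, v, max v w, u, max u w})
    (hF₁ : PreFrobenioid.IsFrobenioid C₁.toElem) (hF₂ : PreFrobenioid.IsFrobenioid C₂.toElem)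
    (H : h.StandardIsotropicNotGroupLike)
    (h411 : C₁.opsData.Cor411ii C₂.opsData h.Ψ) (h411' : C₂.opsData.Cor411ii C₁.opsData h.Ψ.symm)
    (h5₁ : C₁.BsFldPreStepLimitCriterion (PreFrobenioidData.perfection hF₁))
    (h5₂ : C₂.BsFldPreStepLimitCriterion (PreFrobenioidData.perfection hF₂))
    (hR₁ : C₁.Remark363) (hR₂ : C₂.Remark363)
    (hO₁ : C₁.HullEssImageObjClause) (hO₂ : C₂.HullEssImageObjClause) :
    Cor38_ii IsDivSlim h := by
  intro hd hd'
  have hds : C₁.opsData.IsDivSlim ∧ C₂.opsData.IsDivSlim := ⟨hvoc₁ hd, hvoc₂ hd'⟩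
  have h6 : h.PreservesBsFldPreSteps := h.preservesBsFldPreSteps_of_fact h34 hF₁ hF₂ H h411 h411' hds h5₁ h5₂
  have h8 : PreservesBaseFieldTheoretic h :=
    h.preservesBaseFieldTheoretic_of_rows h6 (h.preservesFactorisation_of_fact h34 hF₁ hF₂ H)
      (C₁.hasFactorisations_of_isFrobenioid hF₁) (C₁.bsFldOfFactorisation_of_isFrobenioid hF₁)
      (C₂.bsFldOfFactorisation_of_isFrobenioid hF₂)
  exact ⟨h8, h.inducesHullEquivalence_of_rows hR₁ hR₂ hO₁ hO₂ C₁.hullFaithful_holds C₂.hullFaithful_holds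
    (h.preservesPreSteps_of_fact h34 hF₁ hF₂ H) (h.preservesFrobeniusTrivial_of_fact h34 hF₁ hF₂ H h411 h411' hds)
    h6 h8⟩

/-- **The same, the criterion C38-L05 supplied by its landed proof** (abc-iut-w5-d124's
`bsFldPreStepLimitCriterion_of`): the C38-L05 binders are then, per side, the cell's GAP-LEDGER rows G-w5d124-1
(`hP34Λ`: Prop. 3.4 (ii) at monoid type `Λ`), -2 (`hNZ`: Def. 3.6 (ii)(b), bracketed consequence) and -3 (`hSup`:
suprema along `ℝ·Φ₀^cnst`, [FrdI] Def. 2.4 (i) / Lemma 3.5). [cite: MochizukiEtTh2009, Cor 3.8 p.81] -/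
theorem cor38_ii_of_inputs
    (IsDivSlim : ∀ (E : Type u) [Category.{v} E], (Eᵒᵖ ⥤ CommMonCat.{w}) → Prop)
    (hvoc₁ : IsDivSlim D C₁.divisorMonoid → C₁.opsData.IsDivSlim)
    (hvoc₂ : IsDivSlim D' C₂.divisorMonoid → C₂.opsData.IsDivSlim)
    (h34 : FrdI.Thm34ii.{w, v, max v w, u, max u w})
    (hF₁ : PreFrobenioid.IsFrobenioid C₁.toElem) (hF₂ : PreFrobenioid.IsFrobenioid C₂.toElem)
    (H : h.StandardIsotropicNotGroupLike)
    (h411 : C₁.opsData.Cor411ii C₂.opsData h.Ψ) (h411' : C₂.opsData.Cor411ii C₁.opsData h.Ψ.symm)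
    -- C38-L05 binders (GAP-LEDGER G-w5d124-1/2/3), side 1
    (hP34Λ : ∀ (Y : D₀ᵒᵖ) (b : T.BΛ.obj Y) (r : T.ΦR.obj Y),
      T.divΛ Y b = Algebra.GrothendieckGroup.of r → b ∈ T.FΛ Y)
    (hNZ₁ : ∀ A : Dᵒᵖ, ∃ u : (T.BΛ.obj (C₁.baseOp A) : Type w) × Algebra.GrothendieckGroup (C₁.Φ.carrier A),
      u ∈ C₁.cnstFn A ∧ ∃ Z : C₁.Φ.carrier A, Z ≠ 1 ∧ u.2 = Algebra.GrothendieckGroup.of Z)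
    (hSup₁ : ∀ (W : D) (m : Perfection (C₁.divisorMonoid.obj (op W)))
      (U : Set (Perfection (C₁.divisorMonoid.obj (op W)))),
      U ⊆ C₁.bsFldPf W → U.Nonempty → (∀ u ∈ U, u ∣ m) → ∃ y ∈ C₁.bsFldPf W, (∀ u ∈ U, u ∣ y) ∧ y ∣ m)
    -- … side 2
    (hP34Λ' : ∀ (Y : D₀'ᵒᵖ) (b : T'.BΛ.obj Y) (r : T'.ΦR.obj Y),
      T'.divΛ Y b = Algebra.GrothendieckGroup.of r → b ∈ T'.FΛ Y)
    (hNZ₂ : ∀ A : D'ᵒᵖ, ∃ u : (T'.BΛ.obj (C₂.baseOp A) : Type w) × Algebra.GrothendieckGroup (C₂.Φ.carrier A),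
      u ∈ C₂.cnstFn A ∧ ∃ Z : C₂.Φ.carrier A, Z ≠ 1 ∧ u.2 = Algebra.GrothendieckGroup.of Z)
    (hSup₂ : ∀ (W : D') (m : Perfection (C₂.divisorMonoid.obj (op W)))
      (U : Set (Perfection (C₂.divisorMonoid.obj (op W)))),
      U ⊆ C₂.bsFldPf W → U.Nonempty → (∀ u ∈ U, u ∣ m) → ∃ y ∈ C₂.bsFldPf W, (∀ u ∈ U, u ∣ y) ∧ y ∣ m)
    -- [EtTh] Rmk. 3.6.3, both clauses, both sides
    (hR₁ : C₁.Remark363) (hR₂ : C₂.Remark363)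
    (hO₁ : C₁.HullEssImageObjClause) (hO₂ : C₂.HullEssImageObjClause) :
    Cor38_ii IsDivSlim h :=
  h.cor38_ii_of_criterion IsDivSlim hvoc₁ hvoc₂ h34 hF₁ hF₂ H h411 h411'
    (C₁.bsFldPreStepLimitCriterion_of hF₁ hP34Λ hNZ₁ hSup₁)
    (C₂.bsFldPreStepLimitCriterion_of hF₂ hP34Λ' hNZ₂ hSup₂) hR₁ hR₂ hO₁ hO₂

end Cor38Hyp

end General

/-! ### §3 At the tree's [FrdI] monoid vocabulary `treeMonoidVocab`: the typed statement with its vocabulary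
### parameter INSTANTIATED by [FrdI] Def. 4.5 (iv), Cor. 4.11 (ii) as the 0-ary named fact, and the object clause
### of Rmk. 3.6.3 discharged -/

section Tree

variable {D₀ : Type u₀} [Category.{v₀} D₀] {T : RealifiedDivisorMonoids (D₀ := D₀) treeMonoidVocab.{w}}
  {D : Type u} [Category.{v} D] {VD : FrdICatStub.{u, v, w} D}
  {D₀' : Type u₀} [Category.{v₀} D₀'] {T' : RealifiedDivisorMonoids (D₀ := D₀') treeMonoidVocab.{w}}
  {D' : Type u} [Category.{v} D'] {VD' : FrdICatStub.{u, v, w} D'}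
  {C₁ : TemperedFrobenioid T D VD} {C₂ : TemperedFrobenioid T' D' VD'} (h : Cor38Hyp C₁ C₂)

/-- **[EtTh] Cor. 3.8 (ii) AS TYPED, at the tree's monoid vocabulary, with abc-iut-L2-t3's vocabulary parameter
`IsDivSlim (E) (Φ)` := [FrdI] Def. 4.5 (iv) "`E` is Div-slim relative to `Φ`" — the literal body of L1's
`PreFrobenioidData.IsDivSlim` read on `(E, Φ)` (bridge `⟨·⟩`; abc-iut-w5-d124's instantiation)** — from: `h34` =
[FrdI] Thm. 3.4 (ii) (F-0711, proved), `h411` = [FrdI] Cor. 4.11 (ii) AS THE 0-ARY NAMED FACT `FrdI.Cor411ii`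
(F-0715; `Φ_i` objectwise perf-factorial by Def. 3.6 (ii)), `hF_i` ([FrdI] Thm. 5.2 (ii)), `H` (C38-L01), [EtTh]
Rmk. 3.6.3 `hR_i` (F-0581; its object clause is a theorem here, `hullEssImageObjClause_holds`), and the criterion
C38-L05 at the perfections, both sides. [cite: MochizukiEtTh2009, Cor 3.8 p.81] -/
theorem Cor38Hyp.cor38_ii_of_criterion_tree (h34 : FrdI.Thm34ii.{w, v, max v w, u, max u w})
    (h411 : FrdI.Cor411ii.{w, v, max v w, u, max u w})
    (hF₁ : PreFrobenioid.IsFrobenioid C₁.toElem) (hF₂ : PreFrobenioid.IsFrobenioid C₂.toElem)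
    (H : h.StandardIsotropicNotGroupLike) (hR₁ : C₁.Remark363) (hR₂ : C₂.Remark363)
    (h5₁ : C₁.BsFldPreStepLimitCriterion (PreFrobenioidData.perfection hF₁))
    (h5₂ : C₂.BsFldPreStepLimitCriterion (PreFrobenioidData.perfection hF₂)) :
    Literature.AnabelianGeometry.EtaleTheta.Cor38_ii
      (fun E _ Φ => ∀ (A : E) (α : Aut (Over.forget A)),
        (∀ (B : Over A) (x : Φ.obj (op B.left)),
          Literature.AlgebraicGeometry.Frobenioids.pull Φ (α.hom.app B) x = x) → α = 1) h :=
  h.cor38_ii_of_criterion _ (fun hd => ⟨hd⟩) (fun hd' => ⟨hd'⟩) h34 hF₁ hF₂ H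
    (h411 C₁.toElem C₂.toElem hF₁ hF₂ (fun X => C₁.isPerfFactorial (op X)) (fun X => C₂.isPerfFactorial (op X)) h.Ψ)
    (h411 C₂.toElem C₁.toElem hF₂ hF₁ (fun X => C₂.isPerfFactorial (op X)) (fun X => C₁.isPerfFactorial (op X))
      h.Ψ.symm)
    h5₁ h5₂ hR₁ hR₂ C₁.hullEssImageObjClause_holds C₂.hullEssImageObjClause_holds

end Tree

end Literature.AnabelianGeometry.EtaleTheta
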